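import Summits.CriticalPhenomena.PercolationContinuityZ3.Theorems.PercNearOneGluingNoHeavyQuantBlockCombClass
import HarnessLib

/-!
# QUANT lane R8, FAR on trees: ROOT CONTRACTION of a block-comb and the single-root-block two-plateau family

builds on p205010 (kernel theorem, internal audit signed; external expert review pending)

Support file (`--supports stmt-CriticalPhenomena-4575`), QUANT lane lead (gen 13); memo
`run/shared/lean/prim/quant/prim-quant-lead-g13/LEAD-NOTES-G13.md` N24 (1)(2).  Theorems only (local notation, no definitions),
no sorries, standard axioms.  Model and notation: `…QuantBlockCombMergeModel.lean` (chain gates `q`, levels `lv`, sizes `a`,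
private gates `g`, explicit tail `TAIL = P(N ≥ j+1)`; root level `0`; the marginal of blob `k` is `(∏_{i<lv k} q i)·g k`).

* `Quant.BlockComb.tail_contract_root` — **ROOT CONTRACTION**: if the live mass at the root level is at most `j` (no crossing can be
  completed before the first chain gate is passed) then `TAIL[D+1, q] = q 0 · TAIL[D, q∘succ, lv − 1]` — the proof of
  `Quant.BlockComb.tail_factor` with the weaker hypothesis (natural subtraction keeps root blobs at level `0`, so the contracted instance
  carries the old root blobs AND the old level-`1` blobs at its root, each with its own private gate).
* `Quant.BlockComb.tail_rootGate` / `tail_ge_of_rootGate` — hence the tail depends on the first chain gate only through the factor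
  `q 0`: replacing `q 0` by any `t` multiplies the tail by `t/q 0`; in particular FAR (`x ≤ TAIL`, `x` = the least marginal, itself a
  multiple of `q 0`) for ONE value of the first gate gives it for EVERY value (budget permitting).  Normal form (LEAD-NOTES-G13 N24 (1)):
  in a minimal counterexample to the block-comb row either the root mass is `≥ j+1` or the least reliable ROOT blob is tied.
* `Quant.BlockComb.tail_ge_of_commonRoot_tied` — **THEOREM (FAR for the single-root-block family with tied lower part).**  Root blobs of a
  COMMON gate `ρ` and total size `≤ j`, every deeper live blob TIED at `x` (marginal `= x`), `ρ·q 0 ≤ x`, and `2j < (Σ a)·ρ`; then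
  `x ≤ TAIL`.  Proof: set the first gate to `t = ρ·q 0/x ≤ 1`; the new instance is ALL-TIED at `ρ` (root marginals `ρ`, deeper ones
  `(t/q 0)·x = ρ`), so `Quant.BlockComb.tail_ge_of_class` (p243788) gives `ρ ≤ TAIL[t]`, and `TAIL[q 0] = (q 0/t)·TAIL[t] ≥ (q 0/t)·ρ = x`.
  This is core (α) of LEAD-NOTES-G12 N23 (2g) for ONE root block and ANY number of tied deep blobs (the family of N23 (2f)(iii)'s
  interior minima): the interior of the tied slide is carried by the all-tied instance of a DIFFERENT slide, no location of the
  minimum is needed.  `…_of_budget` is the block-comb reading (`EN = ρ·(root mass) + x·(rest) > 2j`, `x ≤ ρ`).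
Companion file `…QuantBlockCombTwoPlateauRoot.lean`: the complete two-plateau single-root-block theorem (both regimes).
Honest scope: several root blocks of DIFFERENT gates, untied or sure blobs in the middle plateau, and three or more plateaus with
`x < ρ·q 0` are NOT covered (LEAD-NOTES-G13 N24 (2) 'limit', (4)).
-/

namespace Summit.CriticalPhenomena.PercolationContinuityZ3.Theorems

namespace Quant

namespace BlockComb

open Finset

variable {κ : Type*} [Fintype κ] [DecidableEq κ]

/-- product-Bernoulli weight of the set `S` of open blob gates -/
local notation3 "wt[" g ", " S "]" => ∏ k, (if k ∈ (S : Finset κ) then (g : κ → ℝ) k else 1 - (g : κ → ℝ) k)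

/-- probability that the chain `q` of length `D` is open exactly to depth `i` -/
local notation3 "pd[" D ", " q ", " i "]" =>
  (∏ i' ∈ Finset.range (i : ℕ), (q : ℕ → ℝ) i') * (if (i : ℕ) < (D : ℕ) then 1 - (q : ℕ → ℝ) i else 1)

/-- mass counted at depth `i` in blob configuration `S` -/
local notation3 "mass[" lv ", " a ", " i ", " S "]" =>
  ∑ k ∈ (S : Finset κ).filter (fun k => (lv : κ → ℕ) k ≤ (i : ℕ)), ((a : κ → ℕ) k : ℕ)

/-- the tail `P(N ≥ j+1)` of the block-comb count, as an explicit finite sum -/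
local notation3 "TAIL[" D ", " q ", " lv ", " a ", " g ", " j "]" =>
  ∑ i ∈ Finset.range ((D : ℕ) + 1), pd[D, q, i] *
    ∑ S : Finset κ, wt[g, S] * (if (j : ℕ) + 1 ≤ mass[lv, a, i, S] then (1 : ℝ) else 0)

/-! ### 1. Root contraction -/

/-- **Root contraction.**  If the total size of the blobs at the root level is at most `j` then nothing is counted above the
threshold at depth `0`, and `TAIL[D+1, q] = q 0 · TAIL[D, q ∘ succ]` with all levels lowered by one (natural subtraction: the root
blobs stay at level `0` and join the old level-`1` blobs, every blob keeping its private gate). [this work] -/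
theorem tail_contract_root (D : ℕ) (q : ℕ → ℝ) (lv : κ → ℕ) (a : κ → ℕ) (g : κ → ℝ) (j : ℕ)
    (hroot : ∑ k ∈ Finset.univ.filter (fun k => lv k = 0), a k ≤ j) :
    TAIL[D + 1, q, lv, a, g, j] = q 0 * TAIL[D, (fun i => q (i + 1)), (fun k => lv k - 1), a, g, j] := by
  rw [Finset.sum_range_succ']
  -- depth `0`: only root blobs are counted, and their total size is `≤ j`
  have h0 : ∀ S : Finset κ, ¬ (j + 1 ≤ mass[lv, a, 0, S]) := by
    intro S hle
    have hsub : S.filter (fun k => lv k ≤ 0) ⊆ Finset.univ.filter (fun k => lv k = 0) := by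
      intro k hk
      rw [Finset.mem_filter] at hk ⊢
      exact ⟨Finset.mem_univ _, Nat.le_zero.1 hk.2⟩
    have hle' : mass[lv, a, 0, S] ≤ ∑ k ∈ Finset.univ.filter (fun k => lv k = 0), a k :=
      Finset.sum_le_sum_of_subset hsub
    omega
  have hterm0 : pd[D + 1, q, 0] * ∑ S : Finset κ, wt[g, S] * (if j + 1 ≤ mass[lv, a, 0, S] then (1 : ℝ) else 0) = 0 := by
    rw [Finset.sum_eq_zero fun S _ => by rw [if_neg (h0 S), mul_zero], mul_zero]
  rw [hterm0, add_zero, Finset.mul_sum]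
  refine Finset.sum_congr rfl fun i hi => ?_
  -- the depth law
  have hpd : pd[D + 1, q, i + 1] = q 0 * pd[D, (fun i => q (i + 1)), i] := by
    show (∏ i' ∈ Finset.range (i + 1), q i') * (if i + 1 < D + 1 then 1 - q (i + 1) else 1) =
      q 0 * ((∏ i' ∈ Finset.range i, q (i' + 1)) * (if i < D then 1 - q (i + 1) else 1))
    rw [Finset.prod_range_succ']
    by_cases hi' : i < D
    · rw [if_pos hi', if_pos (by omega)]; ring
    · rw [if_neg hi', if_neg (by omega)]; ring
  -- the mass at depth `i+1` is the shifted mass at depth `i`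
  have hmass : ∀ S : Finset κ, mass[lv, a, i + 1, S] = mass[(fun k => lv k - 1), a, i, S] := by
    intro S
    refine Finset.sum_congr ?_ fun _ _ => rfl
    ext k
    simp only [Finset.mem_filter]
    constructor
    · rintro ⟨hk, hle⟩; exact ⟨hk, by omega⟩
    · rintro ⟨hk, hle⟩; exact ⟨hk, by omega⟩
  rw [hpd, mul_assoc]
  congr 1
  congr 1
  exact Finset.sum_congr rfl fun S _ => by rw [hmass S]

/-- **The first chain gate enters only as a factor.**  With root mass `≤ j`, replacing the first gate `q 0` by any real `t`
gives `TAIL[update q 0 t] = t · TAIL[D, q ∘ succ, lv − 1]` — the same contracted tail. [this work] -/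
theorem tail_rootGate (D : ℕ) (q : ℕ → ℝ) (lv : κ → ℕ) (a : κ → ℕ) (g : κ → ℝ) (j : ℕ)
    (hroot : ∑ k ∈ Finset.univ.filter (fun k => lv k = 0), a k ≤ j) (t : ℝ) :
    TAIL[D + 1, Function.update q 0 t, lv, a, g, j] =
      t * TAIL[D, (fun i => q (i + 1)), (fun k => lv k - 1), a, g, j] := by
  have hq : (fun i => Function.update q 0 t (i + 1)) = fun i => q (i + 1) :=
    funext fun i => Function.update_of_ne (Nat.succ_ne_zero i) t q
  have h := tail_contract_root D (Function.update q 0 t) lv a g j hroot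
  rw [Function.update_self, hq] at h
  exact h

/-- **FAR transfers along the first chain gate.**  Root mass `≤ j`, `0 ≤ q 0`, `0 < t`: if the instance with first gate `t`
satisfies `t·y ≤ TAIL[update q 0 t]` then `q 0·y ≤ TAIL[q]`.  (Use: `y` = the least marginal of the contracted instance, so that
`t·y` / `q 0·y` are the least marginals at first gate `t` / `q 0`; the budget `EN = G₀ + (first gate)·(rest)` only grows with
the gate, so FAR may be proved at the LARGEST admissible first gate — the one at which the least reliable root blob is tied, or
`1`.) [this work] -/
theorem tail_ge_of_rootGate (D : ℕ) (q : ℕ → ℝ) (lv : κ → ℕ) (a : κ → ℕ) (g : κ → ℝ) (j : ℕ)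
    (hroot : ∑ k ∈ Finset.univ.filter (fun k => lv k = 0), a k ≤ j) (hq0 : 0 ≤ q 0) (t : ℝ) (ht : 0 < t) (y : ℝ)
    (hfar : t * y ≤ TAIL[D + 1, Function.update q 0 t, lv, a, g, j]) :
    q 0 * y ≤ TAIL[D + 1, q, lv, a, g, j] := by
  rw [tail_rootGate D q lv a g j hroot t] at hfar
  rw [tail_contract_root D q lv a g j hroot]
  have hy : y ≤ TAIL[D, (fun i => q (i + 1)), (fun k => lv k - 1), a, g, j] := le_of_mul_le_mul_left hfar ht
  exact mul_le_mul_of_nonneg_left hy hq0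

/-! ### 2. The single-root-block family with tied lower part -/

/-- Prefix products along `update q 0 t`: for a level `n + 1 ≥ 1` the product picks up `t` in place of `q 0`. [folklore] -/
theorem prefixProd_update_succ (q : ℕ → ℝ) (t : ℝ) (n : ℕ) :
    ∏ i ∈ Finset.range (n + 1), Function.update q 0 t i = t * ∏ i ∈ Finset.range n, q (i + 1) := by
  have h : ∀ i ∈ Finset.range n, Function.update q 0 t (i + 1) = q (i + 1) :=
    fun i _ => Function.update_of_ne (Nat.succ_ne_zero i) t q
  rw [Finset.prod_range_succ', Finset.prod_congr rfl h, Function.update_self, mul_comm]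

/-- Prefix products along `q` itself, split at the first gate. [folklore] -/
theorem prefixProd_succ (q : ℕ → ℝ) (n : ℕ) :
    ∏ i ∈ Finset.range (n + 1), q i = q 0 * ∏ i ∈ Finset.range n, q (i + 1) := by
  rw [Finset.prod_range_succ', mul_comm]

/-- **THEOREM (FAR for the single-root-block family with tied lower part, canonical model).**  Chain `q` of `D+1` gates in
`[0,1]`, blobs with levels `lv k ≤ D+1`, sizes `a k`, private gates `g k ∈ [0,1]`.  Suppose: every live ROOT blob has the same
gate `ρ ≤ 1`; the root blobs have total size `≤ j`; every live blob below the root is TIED at `x > 0` (its marginal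
`(∏_{i<lv k} q i)·g k` equals `x`); `ρ·q 0 ≤ x` (the root block is at most as reliable as the deep private gates `x/q 0…`); and
`2j < (Σ_k a k)·ρ`.  Then `x ≤ TAIL = P(N ≥ j+1)`.  Proof: with first gate `t := ρ·q 0/x ∈ (0,1]` every live marginal equals `ρ`
(all-tied), `Quant.BlockComb.tail_ge_of_class` gives `ρ ≤ TAIL[t]`, and `tail_ge_of_rootGate` carries it back to gate `q 0`
(`q 0·(x/q 0) = x`).  LEAD-NOTES-G13 N24 (2): core (α) of N23 (2g) with one root block, any number of tied deep blobs. [this work] -/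
theorem tail_ge_of_commonRoot_tied (D : ℕ) (q : ℕ → ℝ) (hq : ∀ i, 0 ≤ q i ∧ q i ≤ 1) (lv : κ → ℕ) (a : κ → ℕ)
    (g : κ → ℝ) (hg : ∀ k, 0 ≤ g k ∧ g k ≤ 1) (j : ℕ) (hlv : ∀ k, 0 < a k → lv k ≤ D + 1)
    (ρ x : ℝ) (hρ1 : ρ ≤ 1) (hx : 0 < x)
    (hrootg : ∀ k, 0 < a k → lv k = 0 → g k = ρ)
    (hroot : ∑ k ∈ Finset.univ.filter (fun k => lv k = 0), a k ≤ j)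
    (htied : ∀ k, 0 < a k → lv k ≠ 0 → (∏ i ∈ Finset.range (lv k), q i) * g k = x)
    (hρx : ρ * q 0 ≤ x)
    (hclass : (2 * j : ℝ) < (∑ k', (a k' : ℝ)) * ρ) :
    x ≤ TAIL[D + 1, q, lv, a, g, j] := by
  have hA0 : 0 ≤ ∑ k', (a k' : ℝ) := Finset.sum_nonneg fun k _ => Nat.cast_nonneg _
  -- `ρ > 0`
  have hρpos : 0 < ρ := by
    by_contra h
    push Not at h
    have h1 : (∑ k', (a k' : ℝ)) * ρ ≤ 0 := mul_nonpos_of_nonneg_of_nonpos hA0 h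
    have h2 : (0 : ℝ) ≤ 2 * j := by positivity
    linarith
  -- there is a live blob below the root: the root mass is `≤ j < (Σ a)` since `(Σ a)·ρ > 2j` and `ρ ≤ 1`
  have hdeep : ∃ k, 0 < a k ∧ lv k ≠ 0 := by
    by_contra hnone
    push Not at hnone
    have hall : ∑ k', (a k' : ℝ) = ((∑ k ∈ Finset.univ.filter (fun k => lv k = 0), a k : ℕ) : ℝ) := by
      push_cast
      rw [Finset.sum_filter]
      refine Finset.sum_congr rfl fun k _ => ?_
      by_cases hk : lv k = 0
      · rw [if_pos hk]
      · have : a k = 0 := by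
          by_contra hne
          exact hk (hnone k (Nat.pos_of_ne_zero hne))
        rw [if_neg hk, this, Nat.cast_zero]
    have hle : ∑ k', (a k' : ℝ) ≤ j := by rw [hall]; exact_mod_cast hroot
    have hj0 : (0 : ℝ) ≤ j := Nat.cast_nonneg _
    have : (∑ k', (a k' : ℝ)) * ρ ≤ j := by
      calc (∑ k', (a k' : ℝ)) * ρ ≤ (∑ k', (a k' : ℝ)) * 1 := mul_le_mul_of_nonneg_left hρ1 hA0
        _ ≤ j := by rw [mul_one]; exact hle
    linarith
  -- hence `q 0 > 0` (a tied deep marginal `x > 0` contains the factor `q 0`)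
  have hq0pos : 0 < q 0 := by
    obtain ⟨k, hk, hk0⟩ := hdeep
    obtain ⟨n, hn⟩ := Nat.exists_eq_succ_of_ne_zero hk0
    have hmk := htied k hk hk0
    rw [hn, prefixProd_succ] at hmk
    rcases (hq 0).1.lt_or_eq with h | h
    · exact h
    · exfalso
      rw [← h, zero_mul, zero_mul] at hmk
      linarith
  -- the new first gate
  set t : ℝ := ρ * q 0 / x with ht
  have htpos : 0 < t := div_pos (mul_pos hρpos hq0pos) hx
  have ht1 : t ≤ 1 := by rw [ht, div_le_one hx]; exact hρx
  set q' : ℕ → ℝ := Function.update q 0 t with hq'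
  have hq'mem : ∀ i, 0 ≤ q' i ∧ q' i ≤ 1 := by
    intro i
    by_cases hi : i = 0
    · rw [hi, hq', Function.update_self]; exact ⟨htpos.le, ht1⟩
    · rw [hq', Function.update_of_ne hi]; exact hq i
  -- every live marginal at first gate `t` equals `ρ`
  have hx' : ∀ k, 0 < a k → ρ ≤ (∏ i ∈ Finset.range (lv k), q' i) * g k := by
    intro k hk
    by_cases hk0 : lv k = 0
    · rw [hk0, Finset.prod_range_zero, one_mul, hrootg k hk hk0]
    · obtain ⟨n, hn⟩ := Nat.exists_eq_succ_of_ne_zero hk0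
      have hmk := htied k hk hk0
      rw [hn, prefixProd_succ] at hmk
      rw [hn, hq', prefixProd_update_succ]
      -- `t·P·g = (ρ q0/x)·P·g` and `q0·P·g = x`
      have : t * (∏ i ∈ Finset.range n, q (i + 1)) * g k = ρ := by
        rw [ht]
        have hPg : (∏ i ∈ Finset.range n, q (i + 1)) * g k = x / q 0 := by
          rw [eq_div_iff hq0pos.ne']
          linarith [hmk]
        rw [mul_assoc, hPg]
        field_simp
      rw [this]
  have hne : ∃ k, 0 < a k := by obtain ⟨k, hk, _⟩ := hdeep; exact ⟨k, hk⟩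
  have hfar' : ρ ≤ TAIL[D + 1, q', lv, a, g, j] := tail_ge_of_class (D + 1) q' hq'mem lv a g hg j hlv ρ hx' hclass hne
  -- carry back to the first gate `q 0`: `t·(x/q 0) = ρ`, `q 0·(x/q 0) = x`
  have hy : t * (x / q 0) = ρ := by rw [ht]; field_simp
  have hmain := tail_ge_of_rootGate D q lv a g j hroot (hq 0).1 t htpos (x / q 0) (by rw [hy]; exact hfar')
  rwa [mul_div_cancel₀ x hq0pos.ne'] at hmain

/-- **COROLLARY (block-comb reading: the budget hypothesis).**  Same family, with `2j < (Σ a)·ρ` replaced by the block-comb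
mean condition `2j < ρ·(root mass) + x·(mass below the root)` together with `x ≤ ρ` (the terminal relays are least likely):
then `x ≤ TAIL`.  In gate coordinates (LEAD-NOTES-G10 N21 (0)): ONE root block `(r, ρ)` — or several of a common gate — with
`r ≤ j`, a plateau of tied blobs `(b_k, x/w)` at height `w = q 0` with `ρ·w ≤ x`, deeper tied blobs and the terminal `c` at `x`,
`EN = rρ + (B + c)x > 2j` ⟹ `P(N ≥ j+1) ≥ x`. [this work] -/
theorem tail_ge_of_commonRoot_tied_of_budget (D : ℕ) (q : ℕ → ℝ) (hq : ∀ i, 0 ≤ q i ∧ q i ≤ 1) (lv : κ → ℕ)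
    (a : κ → ℕ) (g : κ → ℝ) (hg : ∀ k, 0 ≤ g k ∧ g k ≤ 1) (j : ℕ) (hlv : ∀ k, 0 < a k → lv k ≤ D + 1)
    (ρ x : ℝ) (hρ1 : ρ ≤ 1) (hxρ : x ≤ ρ) (hx : 0 < x)
    (hrootg : ∀ k, 0 < a k → lv k = 0 → g k = ρ)
    (hroot : ∑ k ∈ Finset.univ.filter (fun k => lv k = 0), a k ≤ j)
    (htied : ∀ k, 0 < a k → lv k ≠ 0 → (∏ i ∈ Finset.range (lv k), q i) * g k = x)
    (hρx : ρ * q 0 ≤ x)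
    (hbudget : (2 * j : ℝ) <
      ρ * ∑ k ∈ Finset.univ.filter (fun k => lv k = 0), (a k : ℝ) +
        x * ∑ k ∈ Finset.univ.filter (fun k => lv k ≠ 0), (a k : ℝ)) :
    x ≤ TAIL[D + 1, q, lv, a, g, j] := by
  refine tail_ge_of_commonRoot_tied D q hq lv a g hg j hlv ρ x hρ1 hx hrootg hroot htied hρx ?_
  have hsplit : ∑ k', (a k' : ℝ) =
      ∑ k ∈ Finset.univ.filter (fun k => lv k = 0), (a k : ℝ) + ∑ k ∈ Finset.univ.filter (fun k => lv k ≠ 0), (a k : ℝ) :=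
    (Finset.sum_filter_add_sum_filter_not Finset.univ (fun k => lv k = 0) (fun k => (a k : ℝ))).symm
  have hB0 : 0 ≤ ∑ k ∈ Finset.univ.filter (fun k => lv k ≠ 0), (a k : ℝ) :=
    Finset.sum_nonneg fun k _ => Nat.cast_nonneg _
  have hρ0 : 0 ≤ ρ := hx.le.trans hxρ
  calc (2 * j : ℝ) < ρ * ∑ k ∈ Finset.univ.filter (fun k => lv k = 0), (a k : ℝ) +
        x * ∑ k ∈ Finset.univ.filter (fun k => lv k ≠ 0), (a k : ℝ) := hbudget
    _ ≤ ρ * ∑ k ∈ Finset.univ.filter (fun k => lv k = 0), (a k : ℝ) +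
        ρ * ∑ k ∈ Finset.univ.filter (fun k => lv k ≠ 0), (a k : ℝ) := by
          have := mul_le_mul_of_nonneg_right hxρ hB0
          linarith
    _ = (∑ k', (a k' : ℝ)) * ρ := by rw [hsplit]; ring

end BlockComb

end Quant

end Summit.CriticalPhenomena.PercolationContinuityZ3.Theorems
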